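import Literature.NumberTheory.LFunctions.DedekindZeta1LogFreeZeroSideDegreeThree
import HarnessLib

/-!
# Bombieri's Théorème 14 for `ζ₁_K` in the middle range, degree `n_K ≤ 3`, uniformly in the field

Topic `Literature/NumberTheory/LFunctions`, namespace `Literature.NumberTheory.LFunctions.NumberField`.
Everything here is PROVED (theorems only; no definitions, no named facts).

The `n_K ≤ 3` twin of `middleRange_Z1` (`DedekindZeta1LogFreeTheorem14.lean`, `n_K ≤ 2`): the proof is that of the
sibling verbatim, with the zero side `zeroSide_Z1_of_finrank_le_three` (Lemme B for `ζ₁_K` in degree `≤ 3`,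
`DedekindZeta1LogFreeLemmaBDegreeThree.lean`, field-independent lower bound `e^{−10}/16 · x^{−r/10}/r³`) in place of
`zeroSide_Z1`; the sieve side (`sieveSide_classGroup`, `ψ = 0` term), the size bounds (`balancePoint_le`,
`secondary_le`, `lemmaAHeight_le`, all stated for `n_K ≤ 4`) and the Lemme de densité about `s = 1`
(`localCount_dedekindZeta₁_le`) are the tree's:

* `middleRange_Z1_of_finrank_le_three` — for every `c₀ > 0` there are absolute `δ₀, A, C > 0` such that for every
  `K` with `n_K ≤ 3`, `P ≥ 2` with `|d_K| ≤ P`, `h_K ≤ P`, `κ_K ≥ 1/P`, every finite set `Z` of zeros of `ζ_K` in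
  `0 < β < 1`, `|γ| ≤ P`, and `c₀/log P ≤ 1 − α ≤ δ₀`: `Σ_{ρ ∈ Z, β ≥ α} m(ρ) ≤ C P^{A(1−α)}`.

The assembly with the small and the trivial range (`logFreeDensity_dedekindZeta₁_of_le_three`) is in
`DedekindZeta1LogFreeTheorem14DegreeThree.lean`.

## References

* [Bombieri1987GrandCrible] E. Bombieri, Astérisque 18 (1987), §6 Théorème 14 (the case of `ζ`).
* [ThornerZaman2017] J. Thorner, A. Zaman, Algebra Number Theory 11 (2017), §5 (Lemma 5.4, Theorem 5.3).
* [ThornerZaman2019] J. Thorner, A. Zaman, Algebra Number Theory 13 (2019) 1039–1068, Thm. 3.2.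
-/

noncomputable section

open Complex Finset Filter Real MeasureTheory
open scoped LSeries.notation ArithmeticFunction.vonMangoldt Topology Nat

namespace Literature.NumberTheory.LFunctions.NumberField

open Literature.NumberTheory.LFunctions.LogFreeLocal Literature.NumberTheory.LFunctions.LogFreeDensity
  Literature.NumberTheory.LFunctions.AbelianDensity
open scoped nonZeroDivisors _root_.NumberField

set_option maxHeartbeats 1600000 in
open scoped Classical in
/-- **Théorème 14 for `ζ₁_K` in the middle range** (degree `n_K ≤ 3`): for every `c₀ > 0` there are
absolute `δ₀, A, C > 0` such that for every `K` with `n_K ≤ 3`, `P ≥ 2` with `|d_K| ≤ P`, `h_K ≤ P`,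
`κ_K ≥ 1/P`, every finite set `Z` of zeros of `ζ_K` in `0 < β < 1`, `|γ| ≤ P`, and
`c₀/log P ≤ 1 − α ≤ δ₀`: `Σ_{ρ ∈ Z, β ≥ α} m(ρ) ≤ C P^{A(1−α)}` (zeros with `|γ| ≥ (4e^{10}+1) r`,
`r = 2(1−α)`, by `zeroSide_Z1_of_finrank_le_three` and the `ψ = 0` term of the sieve side; the others by the
Lemme de densité about `s = 1`). [cite: Bombieri1987GrandCrible, §6 Théorème 14] -/
theorem middleRange_Z1_of_finrank_le_three {c₀ : ℝ} (hc₀ : 0 < c₀) :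
    ∃ δ₀ A C : ℝ, 0 < δ₀ ∧ 0 < A ∧ 0 < C ∧
      ∀ (K : Type*) [Field K] [NumberField K], Module.finrank ℚ K ≤ 3 →
        ∀ P : ℝ, 2 ≤ P → ((NumberField.discr K).natAbs : ℝ) ≤ P →
          (Fintype.card (ClassGroup (𝓞 K)) : ℝ) ≤ P → P⁻¹ ≤ NumberField.dedekindZeta_residue K →
        ∀ Z : Finset ℂ, (∀ ρ ∈ Z, dedekindZeta₁ K ρ = 0 ∧ 0 < ρ.re ∧ ρ.re < 1 ∧ |ρ.im| ≤ P) →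
          ∀ α : ℝ, c₀ / Real.log P ≤ 1 - α → 1 - α ≤ δ₀ →
            ∑ ρ ∈ Z with α ≤ ρ.re, (zeroOrder (dedekindZeta₁ K) ρ : ℝ) ≤ C * P ^ (A * (1 - α)) := by
  obtain ⟨A₀, r₀, C_z, hA₀, hr₀, hC_z, hZS⟩ := zeroSide_Z1_of_finrank_le_three
  set A'' : ℝ := 4 * Real.exp 10 + 1 with hA''
  have hA''pos : 0 < A'' := by positivity
  set a : ℝ := expoB with ha
  have hapos : 0 < a := expoB_pos
  have ha1 : a ≤ 1 / 2 := expoB_le_half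
  set B : ℝ := max 84839040 (max 8 (1 / (2 * c₀))) with hB
  have hB0 : (84839040 : ℝ) ≤ B := le_max_left _ _
  have hB8 : 8 ≤ B := (le_max_left _ _).trans (le_max_right _ _)
  have hBc : 1 / (2 * c₀) ≤ B := (le_max_right _ _).trans (le_max_right _ _)
  have hBpos : 0 < B := by linarith
  set A₁ : ℝ := max A₀ (2200 / (a * B)) with hA₁
  have hA₁pos : 0 < A₁ := lt_of_lt_of_le hA₀ (le_max_left _ _)
  have hA₁A₀ : A₀ ≤ A₁ := le_max_left _ _
  have hA₁a : 2200 / (a * B) ≤ A₁ := le_max_right _ _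
  set C_M : ℝ := 512 * Real.exp 4 / a + 1 with hC_M
  have hC_Mpos : 0 < C_M := by positivity
  set K₁ : ℝ := 256 * π * C_z * C_M * A₁ ^ 2 * B ^ 3 with hK₁
  refine ⟨min (min (r₀ / 2) (1 / 2)) (1 / (8 * (A'' + 1))), (A₁ * B / 10 + 3) * 2 + 2 * B,
    K₁ * Real.exp 10 + 8 * (A'' + 2),
    by positivity, by positivity, by positivity, fun K _ _ hnK P hP hd hh hκ Z hZ α hα1 hα2 => ?_⟩
  have hnK4 : Module.finrank ℚ K ≤ 4 := hnK.trans (by norm_num)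
  /- ── parameters (as in `middleRange_CG`) ── -/
  have hPpos : 0 < P := by linarith
  have hP1 : 1 ≤ P := by linarith
  set Lp : ℝ := Real.log P with hLp
  have hLp2 : Real.log 2 ≤ Lp := Real.log_le_log (by norm_num) hP
  have hlog2 : (0.69 : ℝ) ≤ Real.log 2 := by have := Real.log_two_gt_d9; linarith
  have hLppos : 0 < Lp := by linarith
  set r : ℝ := 2 * (1 - α) with hr
  have hδ : 1 - α ≤ r₀ / 2 := hα2.trans ((min_le_left _ _).trans (min_le_left _ _))
  have hδ' : 1 - α ≤ 1 / 2 := hα2.trans ((min_le_left _ _).trans (min_le_right _ _))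
  have hδ'' : 1 - α ≤ 1 / (8 * (A'' + 1)) := hα2.trans (min_le_right _ _)
  have h1α : c₀ / Lp ≤ 1 - α := hα1
  have h1αpos : 0 < 1 - α := lt_of_lt_of_le (by positivity) h1α
  have hrpos : 0 < r := by rw [hr]; linarith
  have hrr₀ : r ≤ r₀ := by rw [hr]; linarith
  have hr1 : r ≤ 1 := by rw [hr]; linarith
  have hrA'' : (A'' + 1) * r ≤ 1 / 4 := by
    rw [hr]; rw [le_div_iff₀ (by positivity)] at hδ''; nlinarith
  set L' : ℝ := B * Lp with hL'
  have hL'8 : 8 * Lp ≤ L' := by rw [hL']; exact mul_le_mul_of_nonneg_right hB8 hLppos.le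
  have hL'1 : 1 ≤ L' := by linarith
  have hu : 1 ≤ r * L' := by
    rw [hr, hL']
    have h1 : c₀ ≤ (1 - α) * Lp := by rwa [div_le_iff₀ hLppos] at h1α
    have h2 : 1 ≤ 2 * c₀ * B := by
      rw [div_le_iff₀ (by positivity)] at hBc; linarith
    calc (1 : ℝ) ≤ 2 * c₀ * B := h2
      _ ≤ 2 * ((1 - α) * Lp) * B := by nlinarith only [h1, hBpos, hc₀]
      _ = 2 * (1 - α) * (B * Lp) := by ring
  set Lx : ℝ := A₁ * L' with hLx
  set x : ℝ := Real.exp Lx with hx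
  have hxpos : 0 < x := Real.exp_pos _
  have hlogx : Real.log x = Lx := Real.log_exp _
  have hLxA₀ : A₀ * L' ≤ Real.log x := by
    rw [hlogx, hLx]; exact mul_le_mul_of_nonneg_right hA₁A₀ (by positivity)
  have haLx : 2200 * Lp ≤ a * Lx := by
    rw [hLx, hL']
    have h1 : 2200 / (a * B) * (B * Lp) ≤ A₁ * (B * Lp) :=
      mul_le_mul_of_nonneg_right hA₁a (by positivity)
    have h2 : a * (2200 / (a * B) * (B * Lp)) = 2200 * Lp := by field_simp
    calc 2200 * Lp = a * (2200 / (a * B) * (B * Lp)) := h2.symm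
      _ ≤ a * (A₁ * (B * Lp)) := mul_le_mul_of_nonneg_left h1 hapos.le
  have haLx1500 : 1500 ≤ a * Lx := by linarith
  have hLxnn : 0 ≤ Lx := by rw [hLx]; positivity
  have hLx4 : 4 ≤ Lx := by nlinarith only [ha1, hLxnn, haLx1500, hapos]
  have hLx1 : 1 ≤ Lx := by linarith
  have hx1 : 1 ≤ x := by rw [hx]; exact Real.one_le_exp (by linarith)
  set T' : ℝ := P + 1 with hT'
  have hT'1 : 1 ≤ T' := by rw [hT']; linarith
  have hT'0 : 0 ≤ T' := by linarith
  have hT'pos : 0 < T' := by linarith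
  have hT'2 : T' ≤ 2 * P := by rw [hT']; linarith
  /- ── `NX`, `w`, `z` ── -/
  set NX : ℕ := ⌊x ^ a⌋₊ with hNX
  have hxa : x ^ a = Real.exp (a * Lx) := by rw [hx, ← Real.exp_mul, mul_comm]
  have hxa512 : (512 : ℝ) ≤ x ^ a := by
    rw [hxa]; linarith [Real.add_one_le_exp (a * Lx)]
  have hNXle : (NX : ℝ) ≤ x ^ a := Nat.floor_le (by positivity)
  have hNXgt : x ^ a < NX + 1 := Nat.lt_floor_add_one _
  have hNXhalf : x ^ a / 2 ≤ NX := by linarith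
  have hNX256 : (256 : ℝ) ≤ NX := by linarith
  have hNX1 : 1 ≤ NX := by exact_mod_cast (show (1 : ℝ) ≤ NX by linarith)
  have hNXpos : (0 : ℝ) < NX := by linarith
  have hlogNX : a * Lx - 1 ≤ Real.log NX := by
    have h1 : Real.log (x ^ a / 2) ≤ Real.log NX := Real.log_le_log (by positivity) hNXhalf
    rw [Real.log_div (by positivity) two_ne_zero, hxa, Real.log_exp] at h1
    have := Real.log_two_lt_d9
    linarith
  obtain ⟨w, hw⟩ : ∃ w : ℝ, w = (NX : ℝ) ^ ((1 : ℝ) / 8) := ⟨_, rfl⟩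
  have hw0 : 0 < w := by rw [hw]; exact Real.rpow_pos_of_pos hNXpos _
  have hw8 : w ^ 8 = NX := by
    rw [hw, ← Real.rpow_natCast, ← Real.rpow_mul hNXpos.le]; norm_num
  have hw2 : 2 ≤ w := by
    have : (2 : ℝ) ^ 8 ≤ w ^ 8 := by
      rw [hw8]
      calc (2 : ℝ) ^ 8 = 256 := by norm_num
        _ ≤ NX := hNX256
    exact le_of_pow_le_pow_left₀ (by norm_num) hw0.le this
  have hlogw : Real.log w = Real.log NX / 8 := by
    rw [hw, Real.log_rpow hNXpos]; ring
  set z : ℕ := ⌊w⌋₊ with hz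
  have hzle : (z : ℝ) ≤ w := Nat.floor_le hw0.le
  have hzgt : w < z + 1 := Nat.lt_floor_add_one _
  have hz1r : (1 : ℝ) ≤ z := by
    have : (1 : ℕ) ≤ z := Nat.le_floor (by simp only [Nat.cast_one]; linarith)
    exact_mod_cast this
  have hz1 : 1 ≤ z := by exact_mod_cast hz1r
  have hzpos : (0 : ℝ) < z := by linarith
  have hz8 : (z : ℝ) ^ 8 ≤ NX := by rw [← hw8]; exact pow_le_pow_left₀ (Nat.cast_nonneg z) hzle 8
  have hzhalfw : w / 2 ≤ z := by linarith
  have hlogz : a * Lx / 8 - 1 ≤ Real.log z := by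
    have h1 : Real.log (w / 2) ≤ Real.log z := Real.log_le_log (by positivity) hzhalfw
    rw [Real.log_div hw0.ne' two_ne_zero, hlogw] at h1
    have := Real.log_two_lt_d9
    linarith
  have hw_le_NX : w ≤ NX := by
    rw [hw]
    calc (NX : ℝ) ^ ((1 : ℝ) / 8) ≤ (NX : ℝ) ^ (1 : ℝ) :=
          Real.rpow_le_rpow_of_exponent_le (by exact_mod_cast hNX1) (by norm_num)
      _ = NX := Real.rpow_one _
  have hzNX : z ≤ NX := by exact_mod_cast hzle.trans hw_le_NX
  have hzhalf : (z : ℝ) ≤ x ^ (expoB / 2) := by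
    rw [← ha]
    calc (z : ℝ) ≤ w := hzle
      _ = (NX : ℝ) ^ ((1 : ℝ) / 8) := hw
      _ ≤ (NX : ℝ) ^ ((1 : ℝ) / 2) := Real.rpow_le_rpow_of_exponent_le (by exact_mod_cast hNX1) (by norm_num)
      _ ≤ (x ^ a) ^ ((1 : ℝ) / 2) := Real.rpow_le_rpow (Nat.cast_nonneg _) hNXle (by norm_num)
      _ = x ^ (a / 2) := by rw [← Real.rpow_mul hxpos.le]; ring_nf
  /- ── kernel parameters and the saving ── -/
  set nK : ℕ := Module.finrank ℚ K with hnK'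
  set m : ℕ := nK + 3 with hm
  have hm3 : Module.finrank ℚ K + 3 ≤ m := le_rfl
  have hn4 : (nK : ℝ) ≤ 4 := by exact_mod_cast hnK4
  have hmcast : (m : ℝ) = nK + 3 := by rw [hm]; push_cast; ring
  have hm8 : (m : ℝ) + 1 ≤ 8 := by rw [hmcast]; linarith
  have hA2 : 0 < 2 * T' := by positivity
  have hTA : ((m : ℝ) + 1) * T' ^ 2 ≤ 3 * (2 * T') ^ 2 := by nlinarith only [hm8, sq_nonneg T']
  have hmA : ((m : ℝ) + 1) / (2 * T') ≤ 4 := by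
    rw [div_le_iff₀ hA2]; linarith
  obtain ⟨u₀, hu₀def⟩ : ∃ u : ℝ, u = balancePoint K (2 * T') m := ⟨_, rfl⟩
  have hu₀ : Fintype.card (ClassGroup (𝓞 K)) * lemma44Err K (2 * T') m u₀ ≤ NumberField.dedekindZeta_residue K / 2 := by
    rw [hu₀def]; exact (card_mul_lemma44Err_balancePoint (K := K) (2 * T') m).le
  have hu₀le : u₀ ≤ 100 * Lp := by rw [hu₀def]; exact balancePoint_le hP hT'1 hT'2 hnK4 hd hh hκ
  have hden : a * Lx / 16 ≤ Real.log z - u₀ - ((m : ℝ) + 1) / (2 * T') := by linarith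
  have hden1 : 1 ≤ Real.log z - u₀ - ((m : ℝ) + 1) / (2 * T') := by linarith
  have hM : (Fintype.card (ClassGroup (𝓞 K)) : ℝ) * meanValueConst K (2 * T') m z NX ≤ C_M / Lx := by
    have h1 := card_mul_meanValueConst_le (K := K) hA2 hm3 hz1r (NX : ℝ) hu₀ hden1
    have h2 := secondary_le (K := K) hP hT'1 hT'2 hnK4 hd hh hzpos.le hz8 (by exact_mod_cast hNX1)
    rw [← hw] at h2
    have hmain : 4 * ((m : ℝ) + 1) * Real.exp nK / (Real.log z - u₀ - ((m : ℝ) + 1) / (2 * T')) ≤ 512 * Real.exp 4 / a / Lx := by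
      have hnum : 4 * ((m : ℝ) + 1) * Real.exp nK ≤ 32 * Real.exp 4 := by
        have he : Real.exp nK ≤ Real.exp 4 := Real.exp_le_exp.mpr hn4
        have h0 : 0 ≤ Real.exp (nK : ℝ) := (Real.exp_pos _).le
        have h4 : 0 < Real.exp (4 : ℝ) := Real.exp_pos _
        nlinarith only [hm8, he, h0, h4]
      have h1 : 4 * ((m : ℝ) + 1) * Real.exp nK / (Real.log z - u₀ - ((m : ℝ) + 1) / (2 * T')) ≤
          32 * Real.exp 4 / (a * Lx / 16) := div_le_div₀ (by positivity) hnum (by positivity) hden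
      refine h1.trans (le_of_eq ?_)
      field_simp
      ring
    have hsec : P ^ 111 * w⁻¹ ≤ 1 / Lx := by
      have hlogLx : Real.log Lx ≤ a * Lx / 16 := by
        have : 1500 / expoB ≤ Lx := by rw [div_le_iff₀ hapos, mul_comm]; exact haLx1500
        exact log_le_expoB_mul this
      have hwlow : P ^ 111 * Lx ≤ w := by
        have h3 : Real.log (P ^ 111 * Lx) ≤ Real.log w := by
          rw [Real.log_mul (by positivity) (by positivity), Real.log_pow, hlogw]
          push_cast
          linarith
        exact (Real.log_le_log_iff (by positivity) hw0).mp h3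
      have hinv : w⁻¹ ≤ (P ^ 111 * Lx)⁻¹ := inv_anti₀ (by positivity) hwlow
      calc P ^ 111 * w⁻¹ ≤ P ^ 111 * (P ^ 111 * Lx)⁻¹ := mul_le_mul_of_nonneg_left hinv (by positivity)
        _ = 1 / Lx := by field_simp
    calc (Fintype.card (ClassGroup (𝓞 K)) : ℝ) * meanValueConst K (2 * T') m z NX
        ≤ _ := h1
      _ ≤ 512 * Real.exp 4 / a / Lx + 1 / Lx := add_le_add hmain (h2.trans hsec)
      _ = C_M / Lx := by rw [hC_M]; field_simp
  /- ── the sieve side: the `ψ = 0` term ── -/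
  set Bt : ℝ := 16 * π * C_M * Lx with hBt
  have hsieve : ∀ t ∈ Set.Ioc (NX : ℝ) x,
      ∫ v in (-T')..T', ‖summatory (coefSiftedB (coefB K (1 : ClassGroup (𝓞 K) →* ℂˣ) v) x z) t‖ ^ 2 ≤ Bt := by
    intro t ht
    have hall := sieveSide_classGroup (K := K) x hz1 hzNX hT'pos hA2 hm3 hTA t
    -- the `ψ = 0` term is at most the full sum
    have hterm : ∫ v in (-T')..T', ‖summatory (coefSiftedB (coefB K (1 : ClassGroup (𝓞 K) →* ℂˣ) v) x z) t‖ ^ 2 ≤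
        ∑ ψ : AddChar (Additive (ClassGroup (𝓞 K))) ℂ,
          ∫ v in (-T')..T', ‖summatory (coefSiftedB (coefB K (toMulHom ψ).toHomUnits v) x z) t‖ ^ 2 := by
      rw [← toHomUnits_toMulHom_zero (K := K)]
      refine Finset.single_le_sum (f := fun ψ : AddChar (Additive (ClassGroup (𝓞 K))) ℂ ↦
        ∫ v in (-T')..T', ‖summatory (coefSiftedB (coefB K (toMulHom ψ).toHomUnits v) x z) t‖ ^ 2) (fun ψ _ ↦ ?_) (mem_univ _)
      exact intervalIntegral.integral_nonneg (by linarith) fun v _ => by positivity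
    refine hterm.trans (hall.trans ?_)
    have h2 : ∑ n ∈ (siftedSet x z).filter (fun n => n ≤ ⌊t⌋₊), Λ n * Real.log n / n ≤ 2 * Lx ^ 2 := by
      have hsub : (siftedSet x z).filter (fun n => n ≤ ⌊t⌋₊) ⊆ Icc 1 ⌊x⌋₊ := by
        intro n hn
        rw [mem_filter] at hn
        obtain ⟨h1, h2, -⟩ := siftedSet_prop hn.1
        rw [mem_Icc]; omega
      refine (sum_le_sum_of_subset_of_nonneg hsub fun n _ _ => ?_).trans ?_
      · exact div_nonneg (mul_nonneg ArithmeticFunction.vonMangoldt_nonneg (Real.log_natCast_nonneg n)) (Nat.cast_nonneg n)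
      refine (sum_vonMangoldt_mul_log_div_le ⌊x⌋₊).trans ?_
      have hfl : Real.log ⌊x⌋₊ ≤ Lx := by
        rw [← hlogx]
        rcases Nat.eq_zero_or_pos ⌊x⌋₊ with h0 | hpos
        · rw [h0, Nat.cast_zero, Real.log_zero, hlogx]; linarith
        · exact Real.log_le_log (by exact_mod_cast hpos) (Nat.floor_le hxpos.le)
      have hfl0 : 0 ≤ Real.log ⌊x⌋₊ := Real.log_natCast_nonneg _
      have hl4 : Real.log 4 ≤ 1.4 := by
        have h : Real.log 4 = 2 * Real.log 2 := by
          rw [show (4:ℝ) = 2 ^ 2 by norm_num, Real.log_pow]; norm_num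
        rw [h]; have := Real.log_two_lt_d9; linarith
      have h5 : Real.log ⌊x⌋₊ * (Real.log ⌊x⌋₊ + Real.log 4 + 2) ≤ Lx * (Lx + 4) :=
        mul_le_mul hfl (by linarith) (by linarith [Real.log_nonneg (by norm_num : (1:ℝ) ≤ 4)]) hLxnn
      nlinarith only [h5, hLx4]
    have hnK1 : 1 / (Module.finrank ℚ K : ℝ) ≤ 1 := by
      rw [div_le_one (by exact_mod_cast Module.finrank_pos (R := ℚ) (M := K))]
      exact_mod_cast Module.finrank_pos (R := ℚ) (M := K)
    have hsum0 : 0 ≤ ∑ n ∈ (siftedSet x z).filter (fun n => n ≤ ⌊t⌋₊), Λ n * Real.log n / n :=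
      sum_nonneg fun n _ => div_nonneg (mul_nonneg ArithmeticFunction.vonMangoldt_nonneg (Real.log_natCast_nonneg n)) (Nat.cast_nonneg n)
    calc 8 * π * ((Fintype.card (ClassGroup (𝓞 K)) : ℝ) * meanValueConst K (2 * T') m z ⌊x ^ expoB⌋₊ *
          (1 / (Module.finrank ℚ K : ℝ) * ∑ n ∈ (siftedSet x z).filter (fun n => n ≤ ⌊t⌋₊), Λ n * Real.log n / n))
        ≤ 8 * π * (C_M / Lx * (1 * (2 * Lx ^ 2))) := by
          rw [← ha, ← hNX]
          refine mul_le_mul_of_nonneg_left ?_ (by positivity)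
          refine mul_le_mul hM (mul_le_mul hnK1 h2 hsum0 zero_le_one) (by positivity) (by positivity)
      _ = Bt := by rw [hBt]; field_simp; ring
  /- ── the zero side for the far zeros ── -/
  set L₀ : ℝ := Real.exp (-10) / 16 * x ^ (-(r / 10)) / r ^ 3 with hL₀
  have hL₀pos : 0 < L₀ := by rw [hL₀]; positivity
  have hLL' : ∀ v : ℝ, |v| ≤ T' → lemmaAHeight K v ≤ L' := by
    intro v hv
    refine (lemmaAHeight_le hP hnK4 hd (by rw [hT'] at hv; exact hv)).trans ?_
    rw [hL']; exact mul_le_mul_of_nonneg_right hB0 hLppos.le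
  set Zfar := (Z.filter fun ρ ↦ α ≤ ρ.re).filter (fun ρ ↦ A'' * r ≤ |ρ.im|) with hZfar
  set Znear := (Z.filter fun ρ ↦ α ≤ ρ.re).filter (fun ρ ↦ ¬ (A'' * r ≤ |ρ.im|)) with hZnear
  have hsplit : ∑ ρ ∈ Z with α ≤ ρ.re, (zeroOrder (dedekindZeta₁ K) ρ : ℝ) =
      ∑ ρ ∈ Zfar, (zeroOrder (dedekindZeta₁ K) ρ : ℝ) + ∑ ρ ∈ Znear, (zeroOrder (dedekindZeta₁ K) ρ : ℝ) := by
    rw [hZfar, hZnear, ← sum_filter_add_sum_filter_not (Z.filter fun ρ ↦ α ≤ ρ.re) (fun ρ ↦ A'' * r ≤ |ρ.im|)]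
  have hzero : r * L₀ * ∑ ρ ∈ Zfar, (zeroOrder (dedekindZeta₁ K) ρ : ℝ) ≤
      C_z * (r * L') * ∫ v in (-T')..T', meanValueCG (1 : ClassGroup (𝓞 K) →* ℂˣ) x z v := by
    refine hZS K hnK T' r L' x z _ hLL' hrpos hrr₀ hu hx1 hLxA₀ hzhalf hT'0 ?_
    intro ρ hρ
    rw [hZfar, mem_filter, mem_filter] at hρ
    obtain ⟨⟨hρZ, hαρ⟩, hfar⟩ := hρ
    obtain ⟨h0, -, hre1, him⟩ := hZ ρ hρZ
    refine ⟨h0, by rw [hr]; linarith, hre1, ?_, by rw [hA''] at hfar; exact hfar⟩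
    rw [hT', hr]; linarith
  /- ── the near zeros: within `(A''+1) r` of `s = 1` ── -/
  have hnear : ∑ ρ ∈ Znear, (zeroOrder (dedekindZeta₁ K) ρ : ℝ) ≤ 8 * (A'' + 2) * (r * L') := by
    set f := dedekindZeta₁ K with hf
    have hdf : Differentiable ℂ f := differentiable_dedekindZeta₁ K
    have hfc : f (2 + ((0 : ℝ) : ℂ) * I) ≠ 0 := dedekindZeta₁_two_add_ne_zero 0
    set lam : ℝ := (A'' + 1) * r with hlam
    have hlam0 : 0 < lam := by positivity
    have hlam4 : lam ≤ 1 / 4 := hrA''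
    have hmem : ∀ ρ ∈ Znear, ρ ∈ discZeros f 0 ∧ ‖ρ - (1 + ((0 : ℝ) : ℂ) * I)‖ ≤ lam := by
      intro ρ hρ
      rw [hZnear, mem_filter, mem_filter, not_le] at hρ
      obtain ⟨⟨hρZ, hαρ⟩, hnear⟩ := hρ
      obtain ⟨h0, hβ0, hβ1, -⟩ := hZ ρ hρZ
      have hnorm : ‖ρ - (1 + ((0 : ℝ) : ℂ) * I)‖ ≤ lam := by
        have hre : (ρ - (1 + ((0 : ℝ) : ℂ) * I)).re = ρ.re - 1 := by simp
        have him' : (ρ - (1 + ((0 : ℝ) : ℂ) * I)).im = ρ.im := by simp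
        calc ‖ρ - (1 + ((0 : ℝ) : ℂ) * I)‖ ≤ |(ρ - (1 + ((0 : ℝ) : ℂ) * I)).re| + |(ρ - (1 + ((0 : ℝ) : ℂ) * I)).im| :=
              Complex.norm_le_abs_re_add_abs_im _
          _ ≤ r / 2 + A'' * r := by
              rw [hre, him']
              refine add_le_add ?_ hnear.le
              rw [abs_sub_comm, abs_of_nonneg (by linarith)]
              rw [hr]; linarith
          _ ≤ lam := by rw [hlam]; linarith
      refine ⟨(mem_discZeros hdf hfc).2 ⟨?_, h0⟩, hnorm⟩
      rw [Metric.mem_closedBall, dist_eq_norm]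
      calc ‖ρ - (2 + ((0 : ℝ) : ℂ) * I)‖ = ‖(ρ - (1 + ((0 : ℝ) : ℂ) * I)) - 1‖ := by ring_nf
        _ ≤ ‖ρ - (1 + ((0 : ℝ) : ℂ) * I)‖ + ‖(1 : ℂ)‖ := norm_sub_le _ _
        _ ≤ lam + 1 := by rw [norm_one]; linarith
        _ ≤ 31 / 16 := by linarith
    have hsub : Znear ⊆ (discZeros f 0).filter (fun ρ => ‖ρ - (1 + ((0 : ℝ) : ℂ) * I)‖ ≤ lam) := by
      intro ρ hρ; rw [mem_filter]; exact hmem ρ hρ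
    have hcount := localCount_dedekindZeta₁_le (K := K) 0 hlam0 hlam4
    have hℒ0 : lemmaAHeight K 0 ≤ L' := hLL' 0 (by simp; linarith)
    calc ∑ ρ ∈ Znear, (zeroOrder f ρ : ℝ) = ∑ ρ ∈ Znear, (discDivisor f 0 ρ : ℝ) := by
          refine sum_congr rfl fun ρ hρ => ?_
          rw [discDivisor_eq_zeroOrder hdf hfc ((mem_discZeros hdf hfc).1 (hmem ρ hρ).1).1]; norm_cast
      _ ≤ ∑ ρ ∈ (discZeros f 0).filter (fun ρ => ‖ρ - (1 + ((0 : ℝ) : ℂ) * I)‖ ≤ lam), (discDivisor f 0 ρ : ℝ) :=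
          sum_le_sum_of_subset_of_nonneg hsub fun ρ _ _ => by exact_mod_cast discDivisor_nonneg hdf _ ρ
      _ ≤ 8 * (1 + lam * lemmaAHeight K 0) := hcount
      _ ≤ 8 * (1 + lam * L') := by
          have := mul_le_mul_of_nonneg_left hℒ0 hlam0.le; linarith
      _ ≤ 8 * (A'' + 2) * (r * L') := by rw [hlam]; nlinarith [hu, hA''pos]
  /- ── Fubini and the sieve bound for the `ψ = 0` mean value ── -/
  have hNXx : (NX : ℝ) ≤ x := by
    refine hNXle.trans ?_
    exact Real.rpow_le_self_of_one_le hx1 (by linarith)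
  have hstep3 : ∫ v in (-T')..T', meanValueCG (1 : ClassGroup (𝓞 K) →* ℂˣ) x z v ≤ Bt * Lx := by
    set g : ℝ → ℝ := fun t => (∫ v in (-T')..T', ‖summatory (coefSiftedB (coefB K (1 : ClassGroup (𝓞 K) →* ℂˣ) v) x z) t‖ ^ 2) / t with hg
    have hgi : IntegrableOn g (Set.Ioc (NX : ℝ) x) := integrableOn_inner_CG _ x z hNX1 hT'0
    have heq : ∫ v in (-T')..T', meanValueCG (1 : ClassGroup (𝓞 K) →* ℂˣ) x z v = ∫ t in Set.Ioc (NX : ℝ) x, g t := by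
      rw [hg]; exact integral_meanValueCG_eq _ x z hNX1 hT'0
    rw [heq]
    have hBtint : IntegrableOn (fun t : ℝ => Bt * t⁻¹) (Set.Ioc (NX : ℝ) x) := by
      refine ((continuousOn_const.mul (continuousOn_inv₀.mono ?_)).integrableOn_compact isCompact_Icc).mono_set
        Set.Ioc_subset_Icc_self
      intro t ht; exact (hNXpos.trans_le ht.1).ne'
    calc ∫ t in Set.Ioc (NX : ℝ) x, g t ≤ ∫ t in Set.Ioc (NX : ℝ) x, Bt * t⁻¹ := by
          refine setIntegral_mono_on hgi hBtint measurableSet_Ioc fun t ht => ?_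
          have ht0 : 0 < t := hNXpos.trans ht.1
          rw [hg]; dsimp only
          rw [div_eq_mul_inv]
          exact mul_le_mul_of_nonneg_right (hsieve t ht) (inv_nonneg.2 ht0.le)
      _ = Bt * Real.log (x / NX) := by
          rw [integral_const_mul, ← intervalIntegral.integral_of_le hNXx, integral_inv_of_pos hNXpos hxpos]
      _ ≤ Bt * Lx := by
          refine mul_le_mul_of_nonneg_left ?_ (by positivity)
          rw [Real.log_div hxpos.ne' hNXpos.ne', hlogx]
          linarith [Real.log_nonneg (show (1:ℝ) ≤ NX by exact_mod_cast hNX1)]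
  have hmain := hzero.trans (mul_le_mul_of_nonneg_left hstep3 (by positivity))
  /- ── the final arithmetic for the far zeros ── -/
  set S : ℝ := ∑ ρ ∈ Zfar, (zeroOrder (dedekindZeta₁ K) ρ : ℝ) with hS
  have hS0 : 0 ≤ S := sum_nonneg fun ρ _ => Nat.cast_nonneg _
  have hK : C_z * (r * L') * (Bt * Lx) = r * (K₁ * Lp ^ 3) / 16 := by
    rw [hBt, hLx, hL', hK₁]; field_simp; ring
  rw [hK] at hmain
  have hL₀low : Real.exp (-10) * x ^ (-(r / 10)) / r ^ 3 / 16 ≤ L₀ := by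
    rw [hL₀]; exact le_of_eq (by ring)
  set L₁ : ℝ := Real.exp (-10) * x ^ (-(r / 10)) / r ^ 3 with hL₁
  have hL₁pos : 0 < L₁ := by positivity
  have hdiv : S ≤ K₁ * Lp ^ 3 / L₁ := by
    have h1 : r * (L₁ / 16) * S ≤ r * (K₁ * Lp ^ 3) / 16 := by
      have := mul_le_mul_of_nonneg_left (mul_le_mul_of_nonneg_right hL₀low hS0) hrpos.le
      calc r * (L₁ / 16) * S = r * (Real.exp (-10) * x ^ (-(r / 10)) / r ^ 3 / 16 * S) := by rw [hL₁]; ring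
        _ ≤ r * (L₀ * S) := this
        _ = r * L₀ * S := by ring
        _ ≤ _ := hmain
    rw [le_div_iff₀ hL₁pos]
    have h2 := le_of_mul_le_mul_left (show r * (L₁ / 16 * S) ≤ r * (K₁ * Lp ^ 3 / 16) by
      calc r * (L₁ / 16 * S) = r * (L₁ / 16) * S := by ring
        _ ≤ r * (K₁ * Lp ^ 3) / 16 := h1
        _ = r * (K₁ * Lp ^ 3 / 16) := by ring) hrpos
    have h3 := mul_le_mul_of_nonneg_left h2 (by norm_num : (0:ℝ) ≤ 16)
    linarith
  have hxr : x ^ (r / 10) = Real.exp (A₁ * B / 10 * r * Lp) := by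
    rw [hx, ← Real.exp_mul, hLx, hL']; ring_nf
  have hL₁eq : K₁ * Lp ^ 3 / L₁ = K₁ * Real.exp 10 * ((r * Lp) ^ 3 * x ^ (r / 10)) := by
    rw [hL₁, Real.rpow_neg hxpos.le, Real.exp_neg]
    have hx10 : 0 < x ^ (r / 10) := by positivity
    field_simp
  have hcube : (r * Lp) ^ 3 ≤ Real.exp (3 * (r * Lp)) := cube_le_exp (by positivity)
  have hfar_final : S ≤ K₁ * Real.exp 10 * P ^ (((A₁ * B / 10 + 3) * 2 + 2 * B) * (1 - α)) := by
    refine hdiv.trans ?_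
    rw [hL₁eq]
    have hPpow : P ^ ((A₁ * B / 10 + 3) * 2 * (1 - α)) =
        Real.exp (3 * (r * Lp)) * Real.exp (A₁ * B / 10 * r * Lp) := by
      rw [Real.rpow_def_of_pos hPpos, ← Real.exp_add, ← hLp, hr]; ring_nf
    have hmono : P ^ ((A₁ * B / 10 + 3) * 2 * (1 - α)) ≤ P ^ (((A₁ * B / 10 + 3) * 2 + 2 * B) * (1 - α)) :=
      Real.rpow_le_rpow_of_exponent_le hP1 (by nlinarith only [hBpos, h1αpos])
    rw [hxr]
    refine mul_le_mul_of_nonneg_left ((le_of_le_of_eq ?_ hPpow.symm).trans hmono) (by positivity)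
    exact mul_le_mul_of_nonneg_right hcube (Real.exp_pos _).le
  /- ── the near zeros: `8(A''+2) rL' ≤ 8(A''+2) P^{2B(1−α)}` ── -/
  have hnear_final : ∑ ρ ∈ Znear, (zeroOrder (dedekindZeta₁ K) ρ : ℝ) ≤
      8 * (A'' + 2) * P ^ (((A₁ * B / 10 + 3) * 2 + 2 * B) * (1 - α)) := by
    refine hnear.trans (mul_le_mul_of_nonneg_left ?_ (by positivity))
    have hrL' : r * L' = 2 * B * (1 - α) * Lp := by rw [hr, hL']; ring
    calc r * L' ≤ Real.exp (r * L') := by linarith [Real.add_one_le_exp (r * L')]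
      _ = P ^ (2 * B * (1 - α)) := by rw [Real.rpow_def_of_pos hPpos, ← hLp, hrL']; ring_nf
      _ ≤ P ^ (((A₁ * B / 10 + 3) * 2 + 2 * B) * (1 - α)) := by
          refine Real.rpow_le_rpow_of_exponent_le hP1 ?_
          have : 0 ≤ (A₁ * B / 10 + 3) * 2 * (1 - α) := by positivity
          nlinarith only [this]
  rw [hsplit, add_mul]
  exact add_le_add hfar_final hnear_final

end Literature.NumberTheory.LFunctions.NumberField

end
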